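import Summits.BirchSwinnertonDyer.BirchSwinnertonDyer.Theorems.AdditiveKolyvaginRoadToricLocalDefs
import Summits.BirchSwinnertonDyer.BirchSwinnertonDyer.Theorems.AdditiveKolyvaginRoadToricIsotropy
import HarnessLib

/-!
# Route `AdditiveKolyvaginRoad`, crux `KolyvaginPrimitiveAdditive` (item stmt-BirchSwinnertonDyer-20132), stub LOC,
# towards (Supply) at a general prime `p` — (Lag-tor), isotropy clause: the genuine toric condition at a
# Bertolini–Darmon admissible level prime is isotropic for the local Weil cup product
# (toric companion of §2–§3 of koly3b's `…ZhangSupplyOrdinaryLagrangian`)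
# (cell `pub/bsd-wall`, lead prover `bsd-wall-akr-p1` g3; `--supports stmt-BirchSwinnertonDyer-20132`, helper)

WHY THIS FILE. Binder `hordIso` of koly3b's `hjump_of_localLagrangians`, ordinary ↦ toric, for
`Ltor v := AdditiveKoly.toricLocalCondition` (p550390): on augmentation-valued representatives the cup-product
`2`-cochain `(a,b,c) ↦ e(ψ b − ψ a, χ c − χ b)` vanishes identically once `e(A, A) = 0` on the augmentation subgroup
`A`; at a BD-admissible `q` (`[K : ℚ] = 2`) `#A ≤ p` (akr-p1 g2 `natCard_augmentation_le_of_admQ`) and an alternating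
pairing vanishes on a subgroup of order `≤ p` (g2 `weilPairingHom_eq_zero_of_mem_of_card_le`).

WHAT. `cupProduct_eq_zero_of_mem_toricLocalCondition` (any `K`-field `L`, any subgroup-isotropy hypothesis),
`htorIso_toricLocalCondition` (at the place of `q ∈ AdmQ`).

HONEST FRAMING: theorems only; 0 definitions, 0 named facts, 0 `sorry`; closes nothing.

References: [cite: WZhang2014, §4.1, Prop. 5.4] [cite: BertoliniDarmon2005, §2.2–§2.3] [cite: SilvermanAEC2009, Prop. III.8.1].
-/

-- single-conjunct summit: `Summit.BirchSwinnertonDyer.BirchSwinnertonDyer.…` repeats the name by design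
set_option linter.dupNamespace false

noncomputable section

open scoped Classical

universe u

namespace Summit.BirchSwinnertonDyer.BirchSwinnertonDyer.Theorems.AdditiveKoly

open CategoryTheory WeierstrassCurve Field Function NumberField IsDedekindDomain
open Literature.NumberTheory.EllipticCurves Literature.NumberTheory.GaloisRepresentations
open Literature.NumberTheory.GaloisRepresentations.DiscreteGaloisModule (mu MuCarrier)
open Summit.BirchSwinnertonDyer.Rank1Residual.X11b.Three.Koly.Method2
open scoped ContRepresentation

/-! ## §1 Isotropy of the genuine toric condition for the local Weil cup product -/

section Isotropy

variable {K : Type u} [Field K] (E : WeierstrassCurve K) (n : ℕ) [NeZero n]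
variable (L : Type u) [Field L] [Algebra K L] [CompactSpace (absoluteGaloisGroup L)]
variable (e : geomTorsion E n → geomTorsion E n → AlgebraicClosure K)
  (hμ : ∀ S T, e S T ^ n = 1)
  (hadd₁ : ∀ S₁ S₂ T, e (S₁ + S₂) T = e S₁ T * e S₂ T)
  (hadd₂ : ∀ S T₁ T₂, e S (T₁ + T₂) = e S T₁ * e S T₂)
  (hgal : ∀ (σ : absoluteGaloisGroup K) (S T : geomTorsion E n), σ • e S T = e (σ • S) (σ • T))

/-- **Two classes of the genuine toric condition have vanishing local Weil cup product when `e(A, A) = 0`** on the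
augmentation subgroup `A = ⟨res τ • y − y⟩` (koly3b's `cupProduct_eq_zero_of_mem_ordinaryLocalCondition` with
invariant values ↦ augmentation values: the cup-product `2`-cochain `(a,b,c) ↦ e(ψ b − ψ a, χ c − χ b)` vanishes
identically). [cite: WZhang2014, §4.1, Prop. 5.4] [cite: BertoliniDarmon2005, §2.3] -/
theorem cupProduct_eq_zero_of_mem_toricLocalCondition
    (hA : ∀ S ∈ AddSubgroup.closure {m : geomTorsion E n |
        ∃ (τ : absoluteGaloisGroup L) (y : geomTorsion E n), m = absGaloisRestrict K L τ • y - y},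
      ∀ T ∈ AddSubgroup.closure {m : geomTorsion E n |
        ∃ (τ : absoluteGaloisGroup L) (y : geomTorsion E n), m = absGaloisRestrict K L τ • y - y},
      weilPairingHom E n e hμ hadd₁ hadd₂ S T = 0)
    {a b : galoisCohomology (GaloisRep.restrictField L (E.torsionGaloisModule n)) 1}
    (ha : a ∈ toricLocalCondition E L (n : ℤ)) (hb : b ∈ toricLocalCondition E L (n : ℤ)) :
    ((weilContPairing E n e hμ hadd₁ hadd₂ hgal).restrict (absGaloisRestrict K L)).cupProduct a b = 0 := by
  obtain ⟨ψy, hψy, rfl⟩ := ha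
  obtain ⟨ψz, hψz, rfl⟩ := hb
  erw [ContPairing.cupProduct_oneCocycleClass]
  have hcoch : ((weilContPairing E n e hμ hadd₁ hadd₂ hgal).restrict (absGaloisRestrict K L)).cupTwoCochain ψy ψz =
      ((weilContPairing E n e hμ hadd₁ hadd₂ hgal).restrict (absGaloisRestrict K L)).cupTwoCochain 0 ψz := by
    apply Subtype.ext
    refine ContinuousMap.ext fun a => ContinuousMap.ext fun b => ContinuousMap.ext fun c => ?_
    rw [ContPairing.cupTwoCochain_apply, ContPairing.cupTwoCochain_apply]
    change weilPairingHom E n e hμ hadd₁ hadd₂ (ψy.1 b - ψy.1 a) (ψz.1 c - ψz.1 b) =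
      weilPairingHom E n e hμ hadd₁ hadd₂ ((0 : contOneCocycles _).1 b - (0 : contOneCocycles _).1 a)
        (ψz.1 c - ψz.1 b)
    have h0 : ∀ g : absoluteGaloisGroup L, (0 : contOneCocycles (TopRep.res
        (absGaloisRestrict K L : absoluteGaloisGroup L →* absoluteGaloisGroup K)
        (E.torsionGaloisModule n).toTopRep)).1 g = 0 := fun g => rfl
    rw [h0, h0, sub_zero, map_zero, AddMonoidHom.zero_apply,
      hA _ (AddSubgroup.sub_mem _ (hψy b) (hψy a)) _ (AddSubgroup.sub_mem _ (hψz c) (hψz b))]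
  unfold ContPairing.cupClass
  rw [cxClass_congr hcoch]
  exact ContPairing.cupClass_eq_zero_of_left _ 0 ψz (oneCocycleClass_zero _)

end Isotropy

/-! ## §2 At the place of a Bertolini–Darmon admissible level prime -/

section Admissible

variable (W : WeierstrassCurve ℚ) [W.IsElliptic] [W.IsGloballyMinimal] (K : Type) [Field K] [NumberField K]
  (p : ℕ) [Fact p.Prime] [∀ v : Place K, CompactSpace (absoluteGaloisGroup (Place.Completion v))]

/-- **(Lag-tor), isotropy clause `htorIso`** for `Ltor w := toricLocalCondition (W/K) K_w p`: for `[K : ℚ] = 2`, a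
Bertolini–Darmon admissible `q ∈ AdmQ` and the place `w ∣ q`, the genuine toric condition is isotropic for the local
Weil cup product of every alternating Weil-type pairing on `E[p]` (`#⟨res τ • y − y⟩ ≤ p` and `e` vanishes on a subgroup
of order `≤ p`). [cite: WZhang2014, §4.1, Prop. 5.4] [cite: BertoliniDarmon2005, §2.2–§2.3] -/
theorem htorIso_toricLocalCondition (hK2 : Module.finrank ℚ K = 2) (q : AdmQ W K p)
    (w : HeightOneSpectrum (𝓞 K)) (hqw : ((q : ℕ) : 𝓞 K) ∈ w.asIdeal)
    (e : geomTorsion (W.baseChange K) ((p ^ 1 : ℕ) : ℤ) → geomTorsion (W.baseChange K) ((p ^ 1 : ℕ) : ℤ) →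
      AlgebraicClosure K)
    (hμ : ∀ P Q, e P Q ^ (p ^ 1) = 1) (hadd₁ : ∀ P₁ P₂ Q, e (P₁ + P₂) Q = e P₁ Q * e P₂ Q)
    (hadd₂ : ∀ P Q₁ Q₂, e P (Q₁ + Q₂) = e P Q₁ * e P Q₂) (halt : ∀ Q, e Q Q = 1)
    (hgal : ∀ (σ : absoluteGaloisGroup K) (P Q : geomTorsion (W.baseChange K) ((p ^ 1 : ℕ) : ℤ)),
      σ • e P Q = e (σ • P) (σ • Q)) :
    ∀ a ∈ toricLocalCondition (W.baseChange K) (w.adicCompletion K) ((p ^ 1 : ℕ) : ℤ),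
    ∀ b ∈ toricLocalCondition (W.baseChange K) (w.adicCompletion K) ((p ^ 1 : ℕ) : ℤ),
      (weilContPairingLocal (W.baseChange K) (p ^ 1) e hμ hadd₁ hadd₂ hgal (Sum.inr w)).cupProduct a b = 0 := by
  intro a ha b hb
  have hp : p.Prime := Fact.out
  haveI : Fact (Nat.Prime (p ^ 1)) := ⟨by rw [pow_one]; exact hp⟩
  haveI : NeZero (p ^ 1 : ℕ) := ⟨pow_ne_zero 1 hp.ne_zero⟩
  haveI : CompactSpace (absoluteGaloisGroup (w.adicCompletion K)) :=
    ‹∀ v : Place K, CompactSpace (absoluteGaloisGroup (Place.Completion v))› (Sum.inr w)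
  have hcard := natCard_augmentation_le_of_admQ W K p hK2 q w hqw
  exact cupProduct_eq_zero_of_mem_toricLocalCondition (W.baseChange K) (p ^ 1) (w.adicCompletion K) e hμ hadd₁
    hadd₂ hgal (fun S hS T hT ↦ weilPairingHom_eq_zero_of_mem_of_card_le (W.baseChange K) (p ^ 1) e hμ hadd₁ hadd₂
      halt _ hcard S T hS hT) ha hb

end Admissible

end Summit.BirchSwinnertonDyer.BirchSwinnertonDyer.Theorems.AdditiveKoly

end
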